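import Summits.HodgeConjecture.HodgeConjecture.Theorems.LinearSystemTorelliLocalTubeSpanThm29
import Summits.HodgeConjecture.HodgeConjecture.Theorems.LinearSystemTorelliLocalTubeSpanSquaresStep
import Summits.HodgeConjecture.HodgeConjecture.Theorems.LinearSystemTorelliLocalTubeSpanSquaresStrip
import Summits.HodgeConjecture.HodgeConjecture.Theorems.LinearSystemTorelliLocalTubeSpanSquaresPeel
import Summits.HodgeConjecture.HodgeConjecture.Theorems.LinearSystemTorelliLocalTubeSpanPrimitiveMem
import Summits.HodgeConjecture.HodgeConjecture.Theorems.LinearSystemTorelliLocalTubeSpanThreeSquares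
import Summits.HodgeConjecture.HodgeConjecture.Theorems.LinearSystemTorelliLocalTubeSpanUnimodularTransitivity
import Mathlib.Tactic.Module

/-!
# Route LinearSystemTorelli — crux `LocalTubeSpan` (stmt-HodgeConjecture-2490): ALL SQUARES ARE MONODROMY (Part A)

Composition file of line `Sketch`, cycle 9 (continuation lead c7).  For a skew vanishing lattice `Δ` of an
alternating form, the square `T_a² : v ↦ v - 2⟨v,a⟩a` of the transvection along EVERY lattice vector `a ∈ ℤΔ`
lies in the monodromy group `Γ_Δ` (`localTubeSpan_squares_all`) — no named fact.  With
`𝒯₂ := {x : some g ∈ Γ_Δ acts as T_x²}`: the STEP `x ∈ 𝒯₂ ↔ x + δ ∈ 𝒯₂` for `δ ∈ Δ ⟂ x` (`…SquaresStep`),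
STRIP the plane part of `x` w.r.t. a unimodular pair `u, w ∈ Δ` (`…SquaresStrip`, primitive plane vectors are
in `Δ` by `…PrimitiveMem`), PEEL the components along `N_w = {n : w + n ∈ Δ}` (`…SquaresPeel`), and `N_w`
generates the orthogonal of the plane (Janssen's Lemma 2.7, `…Thm29`).  Consequences:

* `localTubeSpan_sp2Elementary_holds` — BOTH elementary families of `Sp♯₂(ℤΔ)`, the squares `T_a²` and the
  pair moves `E_{e,f}² = T_e²T_f²T_{e+f}^{-2}` (`…ThreeSquares`), lie in `Γ_Δ`: the conclusion of cycle 7's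
  `localTubeSpan_sp2Elementary` WITHOUT `Janssen1983_thm2_5`, i.e. `E(ℤΔ) ⊆ Γ_Δ`;
* `localTubeSpan_unimodularTransitivity_holds` — cycle 7's unimodular transitivity with its GLOBAL move
  hypotheses discharged: for `x, y ∈ ℤΔ` with `⟨x,y⟩ = 1`, `Γ_Δ` moves `x` to every unimodular `t ≡ x (mod 2ℤΔ)`.

No named facts; no `sorry`.
-/

-- `Summit.HodgeConjecture.HodgeConjecture.Theorems` is the mandated namespace (single-conjunct summit:
-- Sub = Summit), which `linter.dupNamespace` flags on every declaration; the lakefile turns the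
-- linter off tree-wide (weak option), restated here so stand-alone elaboration is warning-free too.
set_option linter.dupNamespace false

noncomputable section

open Literature.AlgebraicGeometry.HodgeTheory

namespace Summit.HodgeConjecture.HodgeConjecture.Theorems

variable {V : Type} [AddCommGroup V] [Module ℚ V]

/-- **ALL SQUARES ARE MONODROMY (Part A).**  For a skew vanishing lattice and every lattice
vector `x ∈ ℤΔ`, some element of `Γ_Δ` acts as `T_x² : v ↦ v - 2⟨v,x⟩x` — no named fact.  (Strip to
`N = ⟨u,w⟩^⊥`; `N` is generated by `N_w = {n : w + n ∈ Δ}` (Lemma 2.7, the `N`-projection of the partners);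
peel the `N_w`-components one at a time.) [cite: Janssen1983, Thm. 2.5] -/
theorem localTubeSpan_squares_all (B : LinearMap.BilinForm ℚ V) (hB : B.IsAlt) (Δ : Set V)
    (hΔ : IsSkewVanishingLattice B Δ) {x : V} (hx : x ∈ Submodule.span ℤ Δ) :
    ∃ g ∈ transvectionGroup B Δ, ∀ v : V,
      ((g : (V →ₗ[ℚ] V)ˣ) : V →ₗ[ℚ] V) v = v - (2 : ℚ) • (B v x • x) := by
  -- notation: `P y` = some element of `Γ_Δ` acts as `T_y²`
  let P : V → Prop := fun y => ∃ g ∈ transvectionGroup B Δ, ∀ v : V,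
    ((g : (V →ₗ[ℚ] V)ˣ) : V →ₗ[ℚ] V) v = v - (2 : ℚ) • (B v y • y)
  have hint := hΔ.integral
  have hP0 : P 0 := ⟨1, one_mem _, fun v => by
    rw [Units.val_one, Module.End.one_apply, map_zero, zero_smul, smul_zero, sub_zero]⟩
  -- a unimodular pair
  obtain ⟨u, hu, w, hw, huw⟩ := hΔ.exists_pair
  have hwu : B w u = -1 := by rw [← hB.neg_eq, huw]
  have huΛ : u ∈ Submodule.span ℤ Δ := Submodule.subset_span hu
  have hwΛ : w ∈ Submodule.span ℤ Δ := Submodule.subset_span hw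
  -- the step, the primitive vectors, the strip, the peel
  have hstep : ∀ δ ∈ Δ, ∀ y ∈ Submodule.span ℤ Δ, B δ y = 0 → (P y ↔ P (y + δ)) :=
    fun δ hδ y hy hδy => localTubeSpan_squares_step B hB Δ hΔ hδ hy hδy
  have hprim : ∀ α β : ℤ, IsCoprime α β → (α : ℚ) • u + (β : ℚ) • w ∈ Δ :=
    fun α β h => localTubeSpan_primitive_mem B hB Δ hΔ hu hw huw α β h
  have hstrip : ∀ m ∈ Submodule.span ℤ Δ, B u m = 0 → B w m = 0 → ∀ α β : ℤ,
      (P m ↔ P ((α : ℚ) • u + (β : ℚ) • w + m)) :=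
    fun m hm hum hwm α β => localTubeSpan_squares_strip B hB Δ hstep hprim hm hum hwm α β
  have hpeel : ∀ m ∈ Submodule.span ℤ Δ, B u m = 0 → B w m = 0 → ∀ n' ∈ Submodule.span ℤ Δ,
      B u n' = 0 → B w n' = 0 → w + n' ∈ Δ → (P m ↔ P (m - n')) :=
    fun m hm hum hwm n' hn' hun' hwn' hwn'Δ =>
      localTubeSpan_squares_peel B hB Δ hΔ hu hw huw hstep hstrip hm hum hwm hn' hun' hwn' hwn'Δ
  -- the `N`-projection `π y = y - ⟨y,w⟩u + ⟨y,u⟩w`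
  let π : V →ₗ[ℚ] V := LinearMap.id - (B.flip w).smulRight u + (B.flip u).smulRight w
  have hπ : ∀ y, π y = y - B y w • u + B y u • w := fun y => rfl
  have hπu : ∀ y, B u (π y) = 0 := fun y => by
    rw [hπ, map_add, map_sub, map_smul, map_smul, hB.self_eq_zero u, huw, smul_eq_mul, smul_eq_mul,
      mul_zero, sub_zero, mul_one, ← hB.neg_eq y u]
    ring
  have hπw : ∀ y, B w (π y) = 0 := fun y => by
    rw [hπ, map_add, map_sub, map_smul, map_smul, hB.self_eq_zero w, hwu, smul_eq_mul, smul_eq_mul,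
      mul_zero, add_zero, ← hB.neg_eq y w]
    ring
  have hπmem : ∀ y ∈ Submodule.span ℤ Δ, π y ∈ Submodule.span ℤ Δ := fun y hy => by
    obtain ⟨a, ha⟩ := localTubeSpan_integral_span B Δ hint hy hwΛ
    obtain ⟨b, hb⟩ := localTubeSpan_integral_span B Δ hint hy huΛ
    rw [hπ, ha, hb]
    exact Submodule.add_mem _ (Submodule.sub_mem _ hy (localTubeSpan_intCast_smul_mem Δ huΛ a))
      (localTubeSpan_intCast_smul_mem Δ hwΛ b)
  -- `Q y`: translating by `π y` does not change `P` on `N`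
  let Q : V → Prop := fun y => ∀ m ∈ Submodule.span ℤ Δ, B u m = 0 → B w m = 0 → (P m ↔ P (m + π y))
  have hQadd : ∀ y y', π y ∈ Submodule.span ℤ Δ → Q y → Q y' → Q (y + y') := by
    intro y y' hyΛ hQy hQy' m hm hum hwm
    rw [map_add, ← add_assoc]
    exact (hQy m hm hum hwm).trans (hQy' (m + π y) (Submodule.add_mem _ hm hyΛ)
      (by rw [map_add, hum, hπu, add_zero]) (by rw [map_add, hwm, hπw, add_zero]))
  have hQneg : ∀ y, π y ∈ Submodule.span ℤ Δ → Q y → Q (-y) := by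
    intro y hyΛ hQy m hm hum hwm
    have h := hQy (m + π (-y)) (Submodule.add_mem _ hm (by rw [map_neg]; exact Submodule.neg_mem _ hyΛ))
      (by rw [map_add, hum, hπu, add_zero]) (by rw [map_add, hwm, hπw, add_zero])
    rw [map_neg, add_assoc, neg_add_cancel, add_zero] at h
    rw [map_neg]
    exact h.symm
  have hgen := localTubeSpan_janssen_lemma2_7 B hB Δ hΔ hu
  have hsub : ∀ {y}, y ∈ Submodule.span ℤ (insert u {δ ∈ Δ | B u δ = 1}) → y ∈ Submodule.span ℤ Δ :=
    fun {y} hy => by rw [← hgen]; exact hy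
  have hQ : ∀ y ∈ Submodule.span ℤ Δ, Q y := by
    intro y hy
    have hy' : y ∈ Submodule.span ℤ (insert u {δ ∈ Δ | B u δ = 1}) := by rw [hgen]; exact hy
    clear hy
    induction hy' using Submodule.span_induction with
    | mem y hy =>
      intro m hm hum hwm
      rcases Set.mem_insert_iff.1 hy with rfl | hy
      · -- `π u = 0`
        have : π y = 0 := by
          rw [hπ, hB.self_eq_zero y, huw, zero_smul, one_smul, add_zero, sub_self]
        rw [this, add_zero]
      · -- a partner `δ`: `π δ = n_δ` with `w + n_δ ∈ Δ`
        obtain ⟨hyΔ, huy⟩ := hy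
        have hyu : B y u = -1 := by rw [← hB.neg_eq, huy]
        have hyΛ : y ∈ Submodule.span ℤ Δ := Submodule.subset_span hyΔ
        obtain ⟨a, ha⟩ := localTubeSpan_integral_span B Δ hint hyΛ hwΛ
        have hn : π y = y - (a : ℚ) • u - w := by rw [hπ, ha, hyu]; module
        -- `w + π y = y - a u ∈ Δ` (a shear along `u`)
        have hwn : w + π y ∈ Δ := by
          obtain ⟨g, hg, hgv⟩ := localTubeSpan_pairMoves_shear_mem B hB Δ hu a
          have := hΔ.stable g hg y hyΔ
          rw [hgv, hyu] at this
          have e : w + π y = y + (a : ℚ) • ((-1 : ℚ) • u) := by rw [hn]; module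
          rwa [e]
        have hπyΛ := hπmem y hyΛ
        -- peel at `m + π y`
        have h := hpeel (m + π y) (Submodule.add_mem _ hm hπyΛ)
          (by rw [map_add, hum, hπu, add_zero]) (by rw [map_add, hwm, hπw, add_zero])
          (π y) hπyΛ (hπu y) (hπw y) hwn
        rw [add_sub_cancel_right] at h
        exact h.symm
    | zero => intro m hm hum hwm; rw [map_zero, add_zero]
    | add y y' hymem _ ihy ihy' => exact hQadd y y' (hπmem y (hsub hymem)) ihy ihy'
    | smul k y hymem ih =>
      have hyΛ : π y ∈ Submodule.span ℤ Δ := hπmem y (hsub hymem)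
      induction k using Int.induction_on with
      | zero => intro m hm hum hwm; rw [zero_smul, map_zero, add_zero]
      | succ n ihn =>
        rw [add_smul, one_smul]
        exact hQadd _ _ (by rw [map_zsmul]; exact Submodule.smul_mem _ _ hyΛ) ihn ih
      | pred n ihn =>
        rw [sub_smul, one_smul, sub_eq_add_neg]
        have hmem : π ((-(n : ℤ)) • y) ∈ Submodule.span ℤ Δ := by
          rw [neg_smul, map_neg, map_zsmul]
          exact Submodule.neg_mem _ (Submodule.smul_mem _ _ hyΛ)
        exact hQadd _ _ hmem ihn (hQneg y hyΛ ih)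
  -- conclusion: strip `x` to `π x`, then `Q x` at `m = 0`
  obtain ⟨a, ha⟩ := localTubeSpan_integral_span B Δ hint hx hwΛ
  obtain ⟨b, hb⟩ := localTubeSpan_integral_span B Δ hint hx huΛ
  have hxdec : x = (a : ℚ) • u + ((-b : ℤ) : ℚ) • w + π x := by
    rw [hπ, ha, hb]; push_cast; module
  have hPπ : P (π x) := by
    have h := hQ x hx 0 (Submodule.zero_mem _) (map_zero _) (map_zero _)
    rw [zero_add] at h
    exact h.1 hP0
  have h := (hstrip (π x) (hπmem x hx) (hπu x) (hπw x) a (-b)).1 hPπ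
  rw [← hxdec] at h
  exact h


/-- **The elementary level-2 families are monodromy** — the conclusion of `localTubeSpan_sp2Elementary` with
its named-fact hypothesis discharged: for a skew vanishing lattice, (i) for `e, f ∈ ℤΔ` with `⟨e,f⟩ = 0` some
`g ∈ Γ_Δ` acts as `x ↦ x + 2(⟨x,e⟩f + ⟨x,f⟩e)`; (ii) for `a ∈ ℤΔ` some `g ∈ Γ_Δ` acts as `T_a²`.
[cite: Janssen1983, Thm. 2.5] -/
theorem localTubeSpan_sp2Elementary_holds (B : LinearMap.BilinForm ℚ V) (hB : B.IsAlt) (Δ : Set V)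
    (hΔ : IsSkewVanishingLattice B Δ) :
    (∀ e ∈ Submodule.span ℤ Δ, ∀ f ∈ Submodule.span ℤ Δ, B e f = 0 →
      ∃ g ∈ transvectionGroup B Δ, ∀ x : V,
        ((g : (V →ₗ[ℚ] V)ˣ) : V →ₗ[ℚ] V) x = x + (2 : ℚ) • (B x e • f + B x f • e)) ∧
    (∀ a ∈ Submodule.span ℤ Δ, ∃ g ∈ transvectionGroup B Δ, ∀ x : V,
        ((g : (V →ₗ[ℚ] V)ˣ) : V →ₗ[ℚ] V) x = x - (2 : ℚ) • (B x a • a)) := by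
  refine ⟨fun e he f hf hef => ?_, fun a ha => localTubeSpan_squares_all B hB Δ hΔ ha⟩
  obtain ⟨ge, hge, hgev⟩ := localTubeSpan_squares_all B hB Δ hΔ he
  obtain ⟨gf, hgf, hgfv⟩ := localTubeSpan_squares_all B hB Δ hΔ hf
  obtain ⟨gef, hgef, hgefv⟩ := localTubeSpan_squares_all B hB Δ hΔ (Submodule.add_mem _ he hf)
  exact ⟨ge * gf * gef⁻¹, mul_mem (mul_mem hge hgf) (inv_mem hgef),
    localTubeSpan_threeSquares B hB hef ge gf gef hgev hgfv hgefv⟩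

/-- **Unimodular transitivity of the monodromy group**, cycle 7's theorem with its move hypotheses
discharged: for a skew vanishing lattice and `x, y ∈ ℤΔ` with `⟨x, y⟩ = 1`, every unimodular
`t ∈ x + 2ℤΔ` is `g x` for some `g ∈ Γ_Δ`. [cite: Janssen1983, Thm. 2.9] -/
theorem localTubeSpan_unimodularTransitivity_holds (B : LinearMap.BilinForm ℚ V) (hB : B.IsAlt)
    (Δ : Set V) (hΔ : IsSkewVanishingLattice B Δ) {x y : V} (hx : x ∈ Submodule.span ℤ Δ)
    (hy : y ∈ Submodule.span ℤ Δ) (hxy : B x y = 1) {t : V}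
    (ht : ∃ z ∈ Submodule.span ℤ Δ, t = x + (2 : ℚ) • z) (htu : ∃ y' ∈ Submodule.span ℤ Δ, B t y' = 1) :
    ∃ g ∈ transvectionGroup B Δ, ((g : (V →ₗ[ℚ] V)ˣ) : V →ₗ[ℚ] V) x = t := by
  obtain ⟨hpair, hsq⟩ := localTubeSpan_sp2Elementary_holds B hB Δ hΔ
  exact localTubeSpan_unimodularTransitivity B hB Δ hΔ.integral (transvectionGroup B Δ) hpair hsq hx hy
    hxy ht htu

end Summit.HodgeConjecture.HodgeConjecture.Theorems

end
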